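import Summits.KontsevichZagierPeriods.KontsevichZagierPeriods.Theorems.TerasomaMultiplicationNegativeBranchToMaxCellCells

/-!
# `NegativeBranchToMaxCell` (stmt-KontsevichZagierPeriods-14675) — part 2: the Möbius move

MOVE 2 of the chain: translation by the real 2-torsion point `(a₁, 0)` of the level cubic
`E_u : w² = Q(a,u) = a(a − a₁)(a − a₂)(a − a₃)` acts on the `a`-line as the Möbius involution
swapping `0 ↔ a₁`, `a₂ ↔ a₃` (and `∞ ↔ b₁ = (3 − a₁)/2`, the mirror abscissa). In the base
coordinate `t = a₁` (`u = lev t`) it is the RATIONAL map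
`mobius (t, a) = (t, (3 − t)(a − t)/(2a + t − 3))`, an involution exchanging
`Σ_neg = {0<t<1, a<0}` and the middle cell `{0<t<1, t<a<(3−t)/2}`, with the exact Jacobian identity
`Q(μ(a), lev t) = (3(3−t)(1−t)/(2a+t−3)²)² · Q(a, lev t) = (∂μ/∂a)² · Q(a, lev t)` (`Qf_mobius`), so
that `tFun s = (tFun s ∘ mobius) · |det D mobius|` on `Σ_neg` and
`[Σ_neg, tFun s] − [midCell, tFun s] ∈ KZ.changeOfVariablesRel` (`mobius_move`).
Sources: Kontsevich–Zagier 2001 §1.2 rule (2); Cassels 1991 (quartic models of genus-one curves).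
-/

noncomputable section

open MeasureTheory Set Real
open scoped BigOperators

namespace Summit.KontsevichZagierPeriods.TerasomaMultiplication.NegativeBranchToMaxCell

open Literature.NumberTheory.Transcendental
open Literature.NumberTheory.Transcendental.KZ
open Literature.ModelTheory.ExponentialFields (IsSemialgebraic)
open MvPolynomial (aeval X C)

/-! ### The Möbius involution `μ_t(a) = (3 − t)(a − t)/(2a + t − 3)` -/

/-- The fibrewise Möbius involution `(t, a) ↦ (t, (3 − t)(a − t)/(2a + t − 3))`. [folklore] -/
def mobius (x : Fin 2 → ℝ) : Fin 2 → ℝ := ![x 0, (3 - x 0) * (x 1 - x 0) / (2 * x 1 + x 0 - 3)]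

/-- First component. [folklore] -/
@[simp] theorem mobius_apply_zero (x : Fin 2 → ℝ) : mobius x 0 = x 0 := rfl

/-- Second component. [folklore] -/
@[simp] theorem mobius_apply_one (x : Fin 2 → ℝ) :
    mobius x 1 = (3 - x 0) * (x 1 - x 0) / (2 * x 1 + x 0 - 3) := rfl

/-- Jacobian matrix of the Möbius move. [folklore] -/
def mobJac (x : Fin 2 → ℝ) : Matrix (Fin 2) (Fin 2) ℝ :=
  !![1, 0;
    (-2 * x 1 ^ 2 + 4 * x 1 * x 0 - 6 * x 1 + x 0 ^ 2 - 6 * x 0 + 9) / (2 * x 1 + x 0 - 3) ^ 2,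
    3 * (3 - x 0) * (x 0 - 1) / (2 * x 1 + x 0 - 3) ^ 2]

/-- Derivative of the Möbius move. [folklore] -/
def mobius' (x : Fin 2 → ℝ) : (Fin 2 → ℝ) →L[ℝ] (Fin 2 → ℝ) :=
  LinearMap.toContinuousLinearMap (Matrix.toLin' (mobJac x))

/-- Derivative applied to a vector, first component. [folklore] -/
@[simp] theorem mobius'_apply_zero (x v : Fin 2 → ℝ) : mobius' x v 0 = v 0 := by
  change Matrix.toLin' (mobJac x) v 0 = _
  rw [Matrix.toLin'_apply]
  simp [mobJac, Matrix.mulVec, dotProduct, Fin.sum_univ_two]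

/-- Derivative applied to a vector, second component. [folklore] -/
@[simp] theorem mobius'_apply_one (x v : Fin 2 → ℝ) :
    mobius' x v 1 =
      (-2 * x 1 ^ 2 + 4 * x 1 * x 0 - 6 * x 1 + x 0 ^ 2 - 6 * x 0 + 9) / (2 * x 1 + x 0 - 3) ^ 2 * v 0 +
        3 * (3 - x 0) * (x 0 - 1) / (2 * x 1 + x 0 - 3) ^ 2 * v 1 := by
  change Matrix.toLin' (mobJac x) v 1 = _
  rw [Matrix.toLin'_apply]
  simp [mobJac, Matrix.mulVec, dotProduct, Fin.sum_univ_two]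

/-- `det D mobius = ∂μ/∂a = 3(3 − t)(t − 1)/(2a + t − 3)²`. [folklore] -/
theorem det_mobius' (x : Fin 2 → ℝ) :
    (mobius' x).det = 3 * (3 - x 0) * (x 0 - 1) / (2 * x 1 + x 0 - 3) ^ 2 := by
  change LinearMap.det (Matrix.toLin' (mobJac x)) = _
  rw [LinearMap.det_toLin', Matrix.det_fin_two]
  simp [mobJac]

/-- The Möbius move is differentiable off its pole with derivative `mobius'`. [folklore] -/
theorem hasFDerivAt_mobius {x : Fin 2 → ℝ} (hx : 2 * x 1 + x 0 - 3 ≠ 0) :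
    HasFDerivAt mobius (mobius' x) x := by
  have h0 : HasFDerivAt (fun y : Fin 2 → ℝ => y 0)
      (ContinuousLinearMap.proj (R := ℝ) (φ := fun _ : Fin 2 => ℝ) 0) x := hasFDerivAt_apply 0 x
  have h1 : HasFDerivAt (fun y : Fin 2 → ℝ => y 1)
      (ContinuousLinearMap.proj (R := ℝ) (φ := fun _ : Fin 2 => ℝ) 1) x := hasFDerivAt_apply 1 x
  rw [hasFDerivAt_pi']
  refine Fin.forall_fin_two.mpr ⟨?_, ?_⟩
  · have hf : (fun y : Fin 2 → ℝ => mobius y 0) = fun y => y 0 := funext fun y => rfl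
    rw [hf]
    exact h0.congr_fderiv (ContinuousLinearMap.ext fun v => by simp)
  · have hf : (fun y : Fin 2 → ℝ => mobius y 1) =
        fun y => (3 - y 0) * (y 1 - y 0) * (2 * y 1 + y 0 - 3)⁻¹ :=
      funext fun y => by simp [div_eq_mul_inv]
    rw [hf]
    have hnum : HasFDerivAt (fun y : Fin 2 → ℝ => (3 - y 0) * (y 1 - y 0))
        ((3 - x 0) • (ContinuousLinearMap.proj (R := ℝ) (φ := fun _ : Fin 2 => ℝ) 1 -
            ContinuousLinearMap.proj (R := ℝ) (φ := fun _ : Fin 2 => ℝ) 0) +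
          (x 1 - x 0) • (-(ContinuousLinearMap.proj (R := ℝ) (φ := fun _ : Fin 2 => ℝ) 0))) x :=
      (h0.const_sub 3).mul (h1.sub h0)
    have hden : HasFDerivAt (fun y : Fin 2 → ℝ => (2 * y 1 + y 0 - 3)⁻¹)
        ((ContinuousLinearMap.smulRight (1 : ℝ →L[ℝ] ℝ) (-((2 * x 1 + x 0 - 3) ^ 2)⁻¹)).comp
          ((2:ℝ) • ContinuousLinearMap.proj (R := ℝ) (φ := fun _ : Fin 2 => ℝ) 1 +
            ContinuousLinearMap.proj (R := ℝ) (φ := fun _ : Fin 2 => ℝ) 0)) x := by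
      have := (hasFDerivAt_inv hx).comp x (((h1.const_mul (2:ℝ)).add h0).sub_const 3)
      exact this
    refine (hnum.mul hden).congr_fderiv (ContinuousLinearMap.ext fun v => ?_)
    simp
    field_simp
    ring

/-- The pole `2a + t − 3` of the Möbius move after the move:
`2μ + t − 3 = 3(3 − t)(1 − t)/(2a + t − 3)`. [folklore] -/
theorem mobius_den {x : Fin 2 → ℝ} (hx : 2 * x 1 + x 0 - 3 ≠ 0) :
    2 * mobius x 1 + x 0 - 3 = 3 * (3 - x 0) * (1 - x 0) / (2 * x 1 + x 0 - 3) := by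
  rw [mobius_apply_one]
  field_simp
  ring

/-- `μ(a) − t = 3a(1 − t)/(2a + t − 3)`. [folklore] -/
theorem mobius_one_sub {x : Fin 2 → ℝ} (hx : 2 * x 1 + x 0 - 3 ≠ 0) :
    mobius x 1 - x 0 = 3 * x 1 * (1 - x 0) / (2 * x 1 + x 0 - 3) := by
  rw [mobius_apply_one, div_sub' hx, div_eq_div_iff hx hx]
  ring

/-- `(3 − t)/2 − μ(a) = 3(3 − t)(t − 1)/(2(2a + t − 3))`. [folklore] -/
theorem half_sub_mobius_one {x : Fin 2 → ℝ} (hx : 2 * x 1 + x 0 - 3 ≠ 0) :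
    (3 - x 0) / 2 - mobius x 1 = 3 * (3 - x 0) * (x 0 - 1) / (2 * (2 * x 1 + x 0 - 3)) := by
  rw [mobius_apply_one]
  field_simp
  ring

/-- The Möbius move is an involution (off `t = 1`, `t = 3` and the pole). [folklore] -/
theorem mobius_mobius {x : Fin 2 → ℝ} (hx : 2 * x 1 + x 0 - 3 ≠ 0) (h1 : x 0 ≠ 1) (h3 : x 0 ≠ 3) :
    mobius (mobius x) = x := by
  have hden : 2 * mobius x 1 + x 0 - 3 ≠ 0 := by
    rw [mobius_den hx]
    have : (3 - x 0) ≠ 0 := sub_ne_zero.2 (Ne.symm h3)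
    have : (1 - x 0) ≠ 0 := sub_ne_zero.2 (Ne.symm h1)
    exact div_ne_zero (by positivity) hx
  funext i
  fin_cases i
  · rfl
  · change (3 - mobius x 0) * (mobius x 1 - mobius x 0) / (2 * mobius x 1 + mobius x 0 - 3) = x 1
    rw [mobius_apply_zero, mobius_den hx, mobius_one_sub hx]
    have hA : (3 - x 0) ≠ 0 := sub_ne_zero.2 (Ne.symm h3)
    have hB : (1 - x 0) ≠ 0 := sub_ne_zero.2 (Ne.symm h1)
    rw [div_eq_iff (div_ne_zero (by positivity) hx), ← mul_div_assoc, ← mul_div_assoc,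
      div_eq_div_iff hx hx]
    ring

/-- On `Σ_neg` the pole is avoided: `2a + t − 3 < 0`. [folklore] -/
theorem den_neg_of_mem_negCell {x : Fin 2 → ℝ} (hx : x ∈ negCell) : 2 * x 1 + x 0 - 3 < 0 := by
  obtain ⟨-, h1, h2⟩ := hx; linarith

/-- On the middle cell the pole is avoided: `2a + t − 3 < 0`. [folklore] -/
theorem den_neg_of_mem_midCell {x : Fin 2 → ℝ} (hx : x ∈ midCell) : 2 * x 1 + x 0 - 3 < 0 := by
  obtain ⟨-, -, -, h3⟩ := hx; linarith

/-- The Möbius move maps `Σ_neg` into the middle cell: `(−∞, 0) ↦ (t, (3−t)/2)`. [folklore] -/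
theorem mapsTo_mobius_negCell : MapsTo mobius negCell midCell := by
  intro x hx
  have hd := den_neg_of_mem_negCell hx
  obtain ⟨h0, h1, h2⟩ := hx
  refine ⟨h0, h1, ?_, ?_⟩
  · rw [mobius_apply_zero, ← sub_pos, mobius_one_sub hd.ne]
    apply div_pos_of_neg_of_neg _ hd
    have : 0 < 1 - x 0 := by linarith
    nlinarith
  · rw [mobius_apply_zero]
    have h := half_sub_mobius_one hd.ne (x := x)
    have : 0 < 3 * (3 - x 0) * (x 0 - 1) / (2 * (2 * x 1 + x 0 - 3)) := by
      apply div_pos_of_neg_of_neg _ (by linarith)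
      have : 0 < 3 - x 0 := by linarith
      nlinarith
    linarith

/-- The Möbius move maps the middle cell into `Σ_neg`. [folklore] -/
theorem mapsTo_mobius_midCell : MapsTo mobius midCell negCell := by
  intro x hx
  have hd := den_neg_of_mem_midCell hx
  obtain ⟨h0, h1, h2, h3⟩ := hx
  refine ⟨h0, h1, ?_⟩
  rw [mobius_apply_one]
  apply div_neg_of_pos_of_neg _ hd
  have : 0 < 3 - x 0 := by linarith
  nlinarith

/-- The Möbius move is injective on `Σ_neg`. [folklore] -/
theorem injOn_mobius_negCell : InjOn mobius negCell := fun x hx y hy hxy => by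
  rw [← mobius_mobius (den_neg_of_mem_negCell hx).ne (by linarith [hx.2.1]) (by linarith [hx.2.1]),
    ← mobius_mobius (den_neg_of_mem_negCell hy).ne (by linarith [hy.2.1]) (by linarith [hy.2.1]), hxy]

/-- The Möbius move maps `Σ_neg` ONTO the middle cell. [folklore] -/
theorem image_mobius_negCell : mobius '' negCell = midCell := by
  refine mapsTo_mobius_negCell.image_subset.antisymm fun y hy => ?_
  exact ⟨mobius y, mapsTo_mobius_midCell hy,
    mobius_mobius (den_neg_of_mem_midCell hy).ne (by linarith [hy.2.1]) (by linarith [hy.2.1])⟩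

/-- The Möbius move is a `ℚ`-semialgebraic map on `Σ_neg` (rational, pole-free there). [folklore] -/
theorem isSemialgebraicMapOn_mobius : IsSemialgebraicMapOn ℚ negCell mobius := by
  refine IsSemialgebraicMapOn.of_forall isSemialgebraic_negCell (Fin.forall_fin_two.mpr ⟨?_, ?_⟩)
  · exact (isSemialgebraicFunOn_aeval isSemialgebraic_negCell (X 0)).congr fun x _ => by simp
  · refine (isSemialgebraicFunOn_aeval_div_aeval isSemialgebraic_negCell
      ((3 - X 0) * (X 1 - X 0) : MvPolynomial (Fin 2) ℚ) (2 * X 1 + X 0 - 3) fun x hx => ?_).congr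
      fun x _ => ?_
    · simpa using (den_neg_of_mem_negCell hx).ne
    · simp

/-! ### The Jacobian identity and the move -/

/-- **The 2-torsion Jacobian identity**: `Q(μ(a), lev t) = (3(3−t)(1−t)/(2a+t−3)²)² · Q(a, lev t)`,
i.e. `Q ∘ μ = (μ′)² · Q` — translation by a 2-torsion point preserves the invariant differential
`da/√Q`. A polynomial identity given `4·lev t = t(3−t)²`. [folklore] -/
theorem Qf_mobius {x : Fin 2 → ℝ} (hx : 2 * x 1 + x 0 - 3 ≠ 0) :
    Qf (mobius x 1) (lev (x 0)) =
      (3 * (3 - x 0) * (1 - x 0) / (2 * x 1 + x 0 - 3) ^ 2) ^ 2 * Qf (x 1) (lev (x 0)) := by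
  simp only [Qf, lev, mobius_apply_one]
  set D := 2 * x 1 + x 0 - 3 with hD
  field_simp
  rw [hD]
  ring

/-- Square root of the Jacobian identity on `Σ_neg`. [folklore] -/
theorem sqrt_Qf_mobius {x : Fin 2 → ℝ} (hx : x ∈ negCell) :
    Real.sqrt (Qf (mobius x 1) (lev (x 0))) =
      3 * (3 - x 0) * (1 - x 0) / (2 * x 1 + x 0 - 3) ^ 2 * Real.sqrt (Qf (x 1) (lev (x 0))) := by
  have hc : 0 ≤ 3 * (3 - x 0) * (1 - x 0) / (2 * x 1 + x 0 - 3) ^ 2 := by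
    have : 0 < 3 - x 0 := by linarith [hx.2.1]
    have : 0 < 1 - x 0 := by linarith [hx.2.1]
    positivity
  rw [Qf_mobius (den_neg_of_mem_negCell hx).ne, Real.sqrt_mul (sq_nonneg _), Real.sqrt_sq hc]

/-- **Jacobian identity of move 2**: on `Σ_neg`, `tFun s = (tFun s ∘ mobius) · |det D mobius|`. [folklore] -/
theorem tFun_eq_tFun_mobius {s : ℚ} {x : Fin 2 → ℝ} (hx : x ∈ negCell) :
    tFun s x = tFun s (mobius x) * |(mobius' x).det| := by
  have hd := den_neg_of_mem_negCell hx
  have h3 : 0 < 3 - x 0 := by linarith [hx.2.1]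
  have h1 : 0 < 1 - x 0 := by linarith [hx.2.1]
  have hQ : 0 < Real.sqrt (Qf (x 1) (lev (x 0))) := Real.sqrt_pos.2 (Qf_pos_of_mem_negCell hx)
  have hsq := sqrt_Qf_mobius hx
  rw [det_mobius']
  simp only [tFun, mobius_apply_zero]
  rw [hsq]
  set D := 2 * x 1 + x 0 - 3 with hD
  set A := 3 - x 0 with hA
  set B := 1 - x 0 with hB
  set R := Real.sqrt (Qf (x 1) (lev (x 0))) with hR
  have hD0 : D ≠ 0 := hd.ne
  have hc : 0 < 3 * A * B / D ^ 2 := by positivity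
  rw [show 3 * A * (x 0 - 1) / D ^ 2 = -(3 * A * B / D ^ 2) by rw [hB]; ring, abs_neg,
    abs_of_pos hc]
  field_simp

/-- **Move 2 is ONE rule-(2) instance**: for any representations `R = [Σ_neg, tFun s]` and
`R' = [midCell, tFun s]`, `[R] − [R'] ∈ changeOfVariablesRel` along the Möbius involution.
[cite: KontsevichZagier2001, §1.2 rule (2)] -/
theorem mobius_move {s : ℚ} (R R' : IntegralRep 2) (hR : R.domain = negCell)
    (hRi : EqOn R.integrand (tFun s) R.domain) (hR' : R'.domain = midCell)
    (hR'i : EqOn R'.integrand (tFun s) R'.domain) : of R - of R' ∈ changeOfVariablesRel := by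
  refine ⟨2, R, R', mobius, mobius', ?_, fun x hx => ?_, ?_, ?_, fun x hx => ?_, rfl⟩
  · rw [hR]; exact isSemialgebraicMapOn_mobius
  · rw [hR] at hx
    exact (hasFDerivAt_mobius (den_neg_of_mem_negCell hx).ne).hasFDerivWithinAt
  · rw [hR]; exact injOn_mobius_negCell
  · rw [hR', hR, image_mobius_negCell]
  · have hx' : x ∈ negCell := hR ▸ hx
    rw [hRi hx, hR'i (by rw [hR']; exact mapsTo_mobius_negCell hx'), tFun_eq_tFun_mobius hx']

end Summit.KontsevichZagierPeriods.TerasomaMultiplication.NegativeBranchToMaxCell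

end
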